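import Mathlib
import Literature.Computability.AlgebraicComplexity.HessianAtOrigin

/-!
# Crux `GrenetZeon.TwoDimCoefficients` (stmt-ValiantsHypothesis-8062), stub `stub_dualUnipotent`:
# the Hessian of the trace chain `tr(X₀ X₁ ⋯ X_{d-1})` at the zero `(diag(1,…,1,1-w), 1, …, 1)`

Line `dim2_cases` isolates as its only open stub the unipotent trace model
`per_n = α + β·tr(adj A · B)`, `det A ≡ c ≠ 0` (`DualUnipotentBound`: `n² ≤ C·m`).  The model
computes, in width `m = d·w`, the TRACE CHAIN `tr(X₀ X₁ ⋯ X_{d-1})` of `d` generic `w × w` blocks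
(`A = 1 − N`, `N` the block-superdiagonal chain, `B` the corner block; the embedding is the
business of the companion seat val-width-8062-p1 and of `…TraceChainProfile.lean`).  This file
computes the HESSIAN of the trace chain at the point `p = (X₀, 1, …, 1)`,
`X₀ = diag(1, …, 1, 1 − w)` (a zero of the chain, `tr X₀ = 0`), in closed form:

* `traceChain d w` — `tr(X₀ ⋯ X_{d-1})` as an `MvPolynomial (Fin d × Fin w × Fin w) ℂ`, via the
  prefix products `pprod` of the generic blocks `blk`;
* `map_constantCoeff_map_pderiv_map_pderiv_pprod` — the second derivatives at the origin of the
  translated prefix products `M₀ ⋯ M_{k-1}`, `M_a = X_a + K_a`, `K_0 = X₀`, `K_a = 1`: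
  `∂_{(a,i,j)} ∂_{(b,k,l)} = P_a E_{ij} E_{kl}` (`a < b`), `P_0 = 1`, `P_a = X₀`;
* `hess0_trace_pprod_tblk` — **the Hessian of the translated chain is the explicit matrix
  `hessMat d w`**: entry `((a,i,j),(b,k,l)) = [a ≠ b][k = j][l = i]·(μ_a(i) if a < b, μ_b(j) if
  b < a)` with `μ_0 = 1`, `μ_a(x) = λ_x` (`a ≥ 1`), `λ = (1, …, 1, 1 − w)`.

The companion file `…TraceChainProfile.lean` proves `rank hessMat = d·w²` (full) for `d ≥ 2`,
`w ≥ 3`, identifies `hess0 (transl p traceChain)` with `hessMat`, and draws the consequence for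
the stub: with `d = n`, `w = √n` the model carries, in width `n^{3/2} = o(n²)`, a homogeneous
degree-`n` polynomial in `n²` variables with a zero of full Hessian rank `n²` — the exact
"Hessian profile" of `per_n` that the line feeds in through `HessianRankCodimTwo` /
Mignon–Ressayre — so no argument using only that profile can prove `DualUnipotentBound`
(sharpening the degree-2 witness `tr(X·Xᵀ)` of `…DualUnipotentHessianBlind.lean`, p578026, to the
homogeneous, degree-matched case at the iterated-matrix-multiplication rate `m²/d`).

HONEST FRAMING: elementary formal calculus on an explicit polynomial; a statement about a METHOD,
not about the permanent.  `DualUnipotentBound` stays open; `VP ≠ VNP` is not moved.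

References: T. Mignon, N. Ressayre, Int. Math. Res. Not. 2004:79, Thm. 1.1 (Hessian rank at a zero
of an affine determinant); J. M. Landsberg, *Geometry and Complexity Theory* (2017), §6.4
(determinantal complexity, the Hessian method) and §6.3.3 (singular locus of the permanent —
codimension unknown, Question 6.3.3.7); N. Nisan, STOC 1991 (iterated matrix multiplication as the
canonical branching-program polynomial).
-/

-- single-conjunct layout `Summits/ValiantsHypothesis/ValiantsHypothesis`: the duplicated namespace
-- component is mandated by the tree.
set_option linter.dupNamespace false

noncomputable section

namespace Summit.ValiantsHypothesis.ValiantsHypothesis.Cruxes.TwoDimCoefficients.DimTwoCases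

namespace TraceChain

open Literature.Computability.AlgebraicComplexity Matrix MvPolynomial

variable (d w : ℕ)

/-- The variables of the trace chain: `x_{a,i,j}`, `a < d` the block, `i, j < w` the entry.
[folklore] -/
abbrev Var : Type := Fin d × Fin w × Fin w

/-- The `a`-th generic `w × w` block `X_a = (x_{a,i,j})_{i,j}` for `a < d`, and `0` for `a ≥ d`
(blocks are indexed by `ℕ` so that prefix products are a plain recursion). [folklore] -/
def blk (a : ℕ) : Matrix (Fin w) (Fin w) (MvPolynomial (Var d w) ℂ) :=
  if h : a < d then Matrix.of fun i j => X (⟨a, h⟩, i, j) else 0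

/-- The constant blocks of the chosen zero `p = (X₀, 1, …, 1)`: `K 0 = X₀`, `K a = 1` for `a ≥ 1`.
[folklore] -/
def cst (X₀ : Matrix (Fin w) (Fin w) ℂ) (a : ℕ) : Matrix (Fin w) (Fin w) ℂ :=
  if a = 0 then X₀ else 1

/-- The translated affine blocks `M_a = X_a + K_a`. [folklore] -/
def tblk (X₀ : Matrix (Fin w) (Fin w) ℂ) (a : ℕ) : Matrix (Fin w) (Fin w) (MvPolynomial (Var d w) ℂ) :=
  blk d w a + (cst w X₀ a).map C

/-- Prefix products `B 0 ⋯ B (k-1)` of a family of square matrices. [folklore] -/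
def pprod {R : Type} [Semiring R] (B : ℕ → Matrix (Fin w) (Fin w) R) : ℕ → Matrix (Fin w) (Fin w) R
  | 0 => 1
  | k + 1 => pprod B k * B k

/-- The trace chain `tr(X₀ X₁ ⋯ X_{d-1})`, a homogeneous polynomial of degree `d` in the `d·w²`
variables `x_{a,i,j}` (the trace of an iterated product of generic matrices). [folklore] -/
def traceChain : MvPolynomial (Var d w) ℂ := (pprod w (blk d w) d).trace

variable {d w}

/-- `pprod B 0 = 1`. [folklore] -/
@[simp] theorem pprod_zero {R : Type} [Semiring R] (B : ℕ → Matrix (Fin w) (Fin w) R) :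
    pprod w B 0 = 1 := rfl

/-- `pprod B (k+1) = pprod B k · B k`. [folklore] -/
@[simp] theorem pprod_succ {R : Type} [Semiring R] (B : ℕ → Matrix (Fin w) (Fin w) R) (k : ℕ) :
    pprod w B (k + 1) = pprod w B k * B k := rfl

/-- Prefix products commute with entrywise ring homomorphisms. [folklore] -/
theorem pprod_map {R S : Type} [Semiring R] [Semiring S] (f : R →+* S)
    (B : ℕ → Matrix (Fin w) (Fin w) R) (k : ℕ) :
    (pprod w B k).map f = pprod w (fun a => (B a).map f) k := by
  induction k with
  | zero => simp [Matrix.map_one f (map_zero f) (map_one f)]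
  | succ k ih => rw [pprod_succ, pprod_succ, Matrix.map_mul, ih]

/-! ### Matrix calculus for `pderiv` and `constantCoeff` -/

section Calculus

variable {σ : Type} {ι : Type}

/-- Leibniz rule for the entrywise partial derivative of a matrix product. [folklore] -/
theorem map_pderiv_mul [Fintype ι] (s : σ) (A B : Matrix ι ι (MvPolynomial σ ℂ)) :
    (A * B).map (pderiv s) = A.map (pderiv s) * B + A * B.map (pderiv s) := by
  ext i j
  have h : ∀ x : ι, pderiv s (A i x * B x j) = pderiv s (A i x) * B x j + A i x * pderiv s (B x j) := by
    intro x
    rw [Derivation.leibniz, smul_eq_mul, smul_eq_mul]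
    ring
  simp only [Matrix.map_apply, Matrix.mul_apply, Matrix.add_apply, map_sum, h,
    Finset.sum_add_distrib]

/-- The partial derivative of a matrix of constants vanishes. [folklore] -/
theorem map_pderiv_map_C (s : σ) (K : Matrix ι ι ℂ) :
    (K.map (C : ℂ → MvPolynomial σ ℂ)).map (pderiv s) = 0 := by
  ext i j
  simp

/-- `constantCoeff` of a matrix of constants. [folklore] -/
theorem map_C_map_constantCoeff (K : Matrix ι ι ℂ) :
    (K.map (C : ℂ → MvPolynomial σ ℂ)).map constantCoeff = K := by
  ext i j
  simp

end Calculus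

/-! ### Constant terms and derivatives of the blocks -/

section Blocks

variable (X₀ : Matrix (Fin w) (Fin w) ℂ)

/-- The constant prefix products at the point `(X₀, 1, …, 1)`: `1` for `k = 0`, `X₀` for `k ≥ 1`.
[folklore] -/
def cpp (k : ℕ) : Matrix (Fin w) (Fin w) ℂ := if k = 0 then 1 else X₀

/-- `(X_b)(0) = 0`. [folklore] -/
theorem map_constantCoeff_blk (b : ℕ) : (blk d w b).map constantCoeff = 0 := by
  unfold blk
  split_ifs with h
  · ext i j; simp
  · ext i j; simp

/-- `(M_b)(0) = K_b`. [folklore] -/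
theorem map_constantCoeff_tblk (b : ℕ) : (tblk d w X₀ b).map constantCoeff = cst w X₀ b := by
  rw [tblk, Matrix.map_add _ (map_add _), map_constantCoeff_blk, map_C_map_constantCoeff, zero_add]

/-- `∂_{(a,i,j)} X_b = [b = a]·E_{ij}`. [folklore] -/
theorem map_pderiv_blk (s : Var d w) (b : ℕ) :
    (blk d w b).map (pderiv s) =
      if b = (s.1 : ℕ) then Matrix.single s.2.1 s.2.2 (1 : MvPolynomial (Var d w) ℂ) else 0 := by
  obtain ⟨a, i, j⟩ := s
  unfold blk
  by_cases hb : b < d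
  · rw [dif_pos hb]
    by_cases hba : b = (a : ℕ)
    · rw [if_pos hba]
      have ha : (⟨b, hb⟩ : Fin d) = a := Fin.ext hba
      refine Matrix.ext fun i' j' => ?_
      rw [Matrix.map_apply, Matrix.of_apply, pderiv_X, ha]
      change Pi.single (M := fun _ => MvPolynomial (Var d w) ℂ) (a, i, j) 1 (a, i', j') =
        Matrix.single i j (1 : MvPolynomial (Var d w) ℂ) i' j'
      rw [Matrix.single_apply]
      by_cases hij : i = i' ∧ j = j'
      · obtain ⟨rfl, rfl⟩ := hij
        simp
      · rw [if_neg hij, Pi.single_eq_of_ne]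
        intro h
        apply hij
        simp only [Prod.mk.injEq] at h
        exact ⟨h.2.1.symm, h.2.2.symm⟩
    · rw [if_neg hba]
      refine Matrix.ext fun i' j' => ?_
      rw [Matrix.map_apply, Matrix.of_apply, pderiv_X, Matrix.zero_apply, Pi.single_eq_of_ne]
      intro h
      apply hba
      simp only [Prod.mk.injEq] at h
      rw [← h.1]
  · rw [dif_neg hb]
    have hba : b ≠ (a : ℕ) := fun h => hb (h ▸ a.isLt)
    rw [if_neg hba]
    ext i' j'
    simp

/-- `∂_s M_b = ∂_s X_b`. [folklore] -/
theorem map_pderiv_tblk (s : Var d w) (b : ℕ) :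
    (tblk d w X₀ b).map (pderiv s) =
      if b = (s.1 : ℕ) then Matrix.single s.2.1 s.2.2 (1 : MvPolynomial (Var d w) ℂ) else 0 := by
  rw [tblk, Matrix.map_add _ (map_add _), map_pderiv_blk, map_pderiv_map_C, add_zero]

/-- The derivative `∂_t M_b` is a matrix of constants: its derivative vanishes. [folklore] -/
theorem map_pderiv_map_pderiv_tblk (s t : Var d w) (b : ℕ) :
    ((tblk d w X₀ b).map (pderiv t)).map (pderiv s) = 0 := by
  rw [map_pderiv_tblk]
  split_ifs
  · rw [show (Matrix.single t.2.1 t.2.2 (1 : MvPolynomial (Var d w) ℂ)) =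
        (Matrix.single t.2.1 t.2.2 (1 : ℂ)).map C from by rw [Matrix.map_single, C_1],
      map_pderiv_map_C]
  · ext i j; simp

/-- `constantCoeff` of `∂_s M_b`: the `0/1` pattern matrix `[b = a]·E_{ij}` over `ℂ`. [folklore] -/
theorem map_constantCoeff_map_pderiv_tblk (s : Var d w) (b : ℕ) :
    ((tblk d w X₀ b).map (pderiv s)).map constantCoeff =
      if b = (s.1 : ℕ) then Matrix.single s.2.1 s.2.2 (1 : ℂ) else 0 := by
  rw [map_pderiv_tblk]
  split_ifs
  · rw [Matrix.map_single, map_one]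
  · ext i j; simp

/-- **Constant terms of the prefix products**: `(M₀ ⋯ M_{k-1})(0) = 1` (`k = 0`), `= X₀` (`k ≥ 1`).
[folklore] -/
theorem map_constantCoeff_pprod (k : ℕ) :
    (pprod w (tblk d w X₀) k).map constantCoeff = cpp X₀ k := by
  induction k with
  | zero =>
    rw [pprod_zero, cpp, if_pos rfl]
    exact Matrix.map_one _ (map_zero _) (map_one _)
  | succ k ih =>
    rw [pprod_succ, Matrix.map_mul, ih, map_constantCoeff_tblk, cpp, cpp, cst]
    by_cases hk : k = 0
    · subst hk; simp
    · simp [hk]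

/-- **First derivatives of the prefix products at the point**:
`(∂_{(a,i,j)} (M₀ ⋯ M_{k-1}))(0) = [a < k]·P_a·E_{ij}` with `P_0 = 1`, `P_a = X₀` (`a ≥ 1`). [folklore] -/
theorem map_constantCoeff_map_pderiv_pprod (s : Var d w) (k : ℕ) :
    ((pprod w (tblk d w X₀) k).map (pderiv s)).map constantCoeff =
      if (s.1 : ℕ) < k then cpp X₀ s.1 * Matrix.single s.2.1 s.2.2 (1 : ℂ) else 0 := by
  induction k with
  | zero =>
    rw [pprod_zero, if_neg (Nat.not_lt_zero _)]
    ext i j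
    by_cases h : i = j
    · subst h; simp
    · simp [Matrix.one_apply_ne h]
  | succ k ih =>
    rw [pprod_succ, map_pderiv_mul, Matrix.map_add _ (map_add _), Matrix.map_mul, Matrix.map_mul,
      ih, map_constantCoeff_tblk, map_constantCoeff_pprod, map_constantCoeff_map_pderiv_tblk, cst,
      cpp, cpp]
    split_ifs <;> first | (exfalso; omega) | simp

set_option maxHeartbeats 400000 in
/-- **Second derivatives of the prefix products at the point**: for `a ≠ b` both `< k`,
`(∂_{(a,i,j)} ∂_{(b,k,l)} (M₀ ⋯ M_{k-1}))(0) = P_a E_{ij} E_{kl}` if `a < b` and `P_b E_{kl} E_{ij}`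
if `b < a`; zero otherwise (each `M_c` is affine in its own block of variables). [folklore] -/
theorem map_constantCoeff_map_pderiv_map_pderiv_pprod (s t : Var d w) (k : ℕ) :
    (((pprod w (tblk d w X₀) k).map (pderiv t)).map (pderiv s)).map constantCoeff =
      if (s.1 : ℕ) < k ∧ (t.1 : ℕ) < k ∧ (s.1 : ℕ) ≠ (t.1 : ℕ) then
        (if (s.1 : ℕ) < (t.1 : ℕ) then
            cpp X₀ s.1 * Matrix.single s.2.1 s.2.2 (1 : ℂ) * Matrix.single t.2.1 t.2.2 1
          else cpp X₀ t.1 * Matrix.single t.2.1 t.2.2 (1 : ℂ) * Matrix.single s.2.1 s.2.2 1)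
      else 0 := by
  induction k with
  | zero =>
    rw [pprod_zero, if_neg (by omega)]
    ext i j
    by_cases h : i = j
    · subst h; simp
    · simp [Matrix.one_apply_ne h]
  | succ k ih =>
    rw [pprod_succ, map_pderiv_mul, Matrix.map_add _ (map_add _), map_pderiv_mul, map_pderiv_mul,
      map_pderiv_map_pderiv_tblk, Matrix.mul_zero, add_zero, Matrix.map_add _ (map_add _),
      Matrix.map_add _ (map_add _), Matrix.map_mul, Matrix.map_mul, Matrix.map_mul, ih,
      map_constantCoeff_tblk, map_constantCoeff_map_pderiv_pprod,
      map_constantCoeff_map_pderiv_pprod, map_constantCoeff_map_pderiv_tblk,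
      map_constantCoeff_map_pderiv_tblk, cst, cpp, cpp]
    split_ifs <;> first | (exfalso; omega) | simp

end Blocks

/-! ### The Hessian of the translated trace chain at the origin -/

section Hessian

/-- The eigenvalues of the chosen first block `X₀ = diag(1, …, 1, 1 - w)` (trace zero). [folklore] -/
def lam (w : ℕ) (x : Fin w) : ℂ := if (x : ℕ) + 1 = w then 1 - (w : ℂ) else 1

/-- The first block of the chosen zero: `X₀ = diag(1, …, 1, 1 - w)`. [folklore] -/
def X0 (w : ℕ) : Matrix (Fin w) (Fin w) ℂ := Matrix.diagonal (lam w)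

/-- The diagonal of the constant prefix product `P_c`: `1` for `c = 0`, `λ_x` for `c ≥ 1`. [folklore] -/
def mu (w : ℕ) (c : ℕ) (x : Fin w) : ℂ := if c = 0 then 1 else lam w x

/-- The explicit Hessian of `tr((X₀ + X_0)(1 + X_1) ⋯ (1 + X_{d-1}))` at the origin: the entry
`((a,i,j),(b,k,l))` is `0` unless `a ≠ b`, `k = j`, `l = i`, and then equals `μ_a(i)` if `a < b` and
`μ_b(j)` if `b < a`. [folklore] -/
def hessMat (d w : ℕ) : Matrix (Var d w) (Var d w) ℂ :=
  Matrix.of fun s t =>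
    if (s.1 : ℕ) ≠ (t.1 : ℕ) ∧ t.2.1 = s.2.2 ∧ t.2.2 = s.2.1 then
      (if (s.1 : ℕ) < (t.1 : ℕ) then mu w s.1 s.2.1 else mu w t.1 s.2.2)
    else 0

/-- Entries of the constant prefix products for `X₀ = diag(λ)`: `(P_c)_{xy} = [x = y]·μ_c(y)`.
[folklore] -/
theorem cpp_X0_apply (c : ℕ) (x y : Fin w) :
    cpp (X0 w) c x y = if x = y then mu w c y else 0 := by
  unfold cpp X0 mu
  by_cases hc : c = 0
  · subst hc
    simp [Matrix.one_apply]
  · simp [hc, Matrix.diagonal_apply]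
    -- align `lam w x` vs `lam w y` under `x = y`
    split_ifs with h
    · subst h; rfl
    · rfl

/-- The Hessian at the origin of a trace is the trace of the entrywise second derivatives at the
origin. [folklore] -/
theorem hess0_trace_apply {ι : Type} [Fintype ι] (P : Matrix ι ι (MvPolynomial (Var d w) ℂ))
    (s t : Var d w) :
    hess0 P.trace s t = (((P.map (pderiv t)).map (pderiv s)).map constantCoeff).trace := by
  rw [hess0_apply]
  simp only [Matrix.trace, Matrix.diag, map_sum, Matrix.map_apply]

/-- `tr(P_c · E_{ij} · E_{kl}) = [k = j][l = i]·μ_c(i)`. [folklore] -/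
theorem trace_cpp_single_single (c : ℕ) (i j k l : Fin w) :
    (cpp (X0 w) c * Matrix.single i j (1 : ℂ) * Matrix.single k l 1).trace =
      if k = j ∧ l = i then mu w c i else 0 := by
  rw [Matrix.trace_mul_single, MulOpposite.op_one, one_smul]
  by_cases hk : k = j
  · subst hk
    rw [Matrix.mul_single_apply_same, mul_one, cpp_X0_apply]
    by_cases hl : l = i
    · subst hl; simp
    · simp [hl]
  · rw [if_neg (fun h => hk h.1)]
    have : (cpp (X0 w) c * Matrix.single i j (1 : ℂ)) l k = 0 :=
      Matrix.mul_single_apply_of_ne (hbj := hk) ..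
    exact this

/-- **The Hessian of the translated trace chain is `hessMat`.** [folklore] -/
theorem hess0_trace_pprod_tblk :
    hess0 (pprod w (tblk d w (X0 w)) d).trace = hessMat d w := by
  ext s t
  rw [hess0_trace_apply, map_constantCoeff_map_pderiv_map_pderiv_pprod]
  obtain ⟨a, i, j⟩ := s
  obtain ⟨b, k, l⟩ := t
  simp only [hessMat, Matrix.of_apply]
  have ha := a.isLt
  have hb := b.isLt
  by_cases hab : (a : ℕ) ≠ (b : ℕ)
  · rw [if_pos ⟨ha, hb, hab⟩]
    by_cases hlt : (a : ℕ) < (b : ℕ)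
    · rw [if_pos hlt, trace_cpp_single_single]
      by_cases h : k = j ∧ l = i
      · rw [if_pos h, if_pos ⟨hab, h⟩, if_pos hlt]
      · rw [if_neg h, if_neg (fun h' => h h'.2)]
    · rw [if_neg hlt, trace_cpp_single_single]
      by_cases h : k = j ∧ l = i
      · obtain ⟨rfl, rfl⟩ := h
        rw [if_pos ⟨rfl, rfl⟩, if_pos ⟨hab, rfl, rfl⟩, if_neg hlt]
      · rw [if_neg (fun h' => h ⟨h'.2.symm, h'.1.symm⟩), if_neg (fun h' => h h'.2)]
  · rw [if_neg (fun h => hab h.2.2), if_neg (fun h => hab h.1), Matrix.trace_zero]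

end Hessian

end TraceChain

end Summit.ValiantsHypothesis.ValiantsHypothesis.Cruxes.TwoDimCoefficients.DimTwoCases

end
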